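import Summits.CriticalPhenomena.CardyFormulaZ2.Theorems.IKLinearTransport.Negative.CruxConsequences
import Summits.CriticalPhenomena.CardyFormulaZ2.Theorems.IKLinearTransport.Negative.LoadBearing
import Summits.CriticalPhenomena.CardyFormulaZ2.Theorems.IKLinearTransport.Negative.Covariance

/-!
# Disproof work file — crux `CardyIKTransport.IKLinearTransport` (stmt-CriticalPhenomena-5076)

Standing adversary (cdisprove) on the crux statement itself. Everything conclusive is LANDED and importable:
`Summits/…/Theorems/IKLinearTransport/Negative/CruxConsequences.lean` (p73336) and `…/Negative/LoadBearing.lean`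
(p74203), namespace `Summit.CriticalPhenomena.CardyFormulaZ2.Theorems.IKLinearTransport.Negative` — this work file
and `…/Negative/Covariance.lean` (p74607); this work file imports them and keeps the prose record (§4 resistances, §5 targets).
FINDINGS (index):

* §1 `crux_iff_cardyOnImages` — given Smirnov's theorem (PROVED in the tree,
  `hasCrossingLimit_triDomainCrossingProb_holds`) and the existence/uniqueness of the conformal
  modulus (`exists_isUniformizing_holds`), the crux is EQUIVALENT to: there is a real-linear
  automorphism `K` such that the crude IK crossing probability of every conformal rectangle `R`
  converges to Cardy's value `F(η(K R))`. So the `∀ L, … ↔ …` shape carries no slack: it is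
  Cardy's formula for `P_IK` read in `K`-images, nothing weaker. `conjugateToTri_congr_mul`: `K` is
  determined at most up to a conformal similarity `z ↦ c z` (the crux alone never pins `K`);
  `conjugateToTri_covariance`: the crux forces the limit points of `P_IK` to be invariant under the
  one-parameter group `E_c = K⁻¹ (c ·) K` (second kill shape: two rectangles `R`, `E_c R` with
  different limits).
* §2 `crux_forces_limits_mem_Ioo` — NECESSARY CONDITION (the disprover's target): the crux
  implies that for EVERY conformal rectangle the crude IK crossing probabilities converge to a
  limit in `(0, 1)`. A single rectangle where `P_IK` tends to `0`, to `1`, or oscillates kills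
  the crux (`not_conjugateToTri_of_tendsto`, `not_conjugateToTri_of_not_tendsto`); in
  particular any proof must deliver RSW-type bounds for the non-FKG IK field in every Jordan
  rectangle (cf. the line's stub `ConditionalRSW`).
* §3 LOAD-BEARING ANALYSIS as theorems:
  - `iKLinearTransport_false_without_axisBits` — drop the two fair axis ("gauge") bit fields
    `ω.1, ω.2.1` from the colour rule: the colour field then has a deterministic WHITE CROSS on
    the coordinate axes at every mesh, the crude crossing event of the conformal rectangle
    `R₀ = (1 - i)·𝔻` (arcs `0`/`2` to the right/left of the imaginary axis) is EMPTY for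
    `δ < 1/2`, `P ≡ 0` there, contradiction with §2. Any proof must use the axis bits (they are
    what makes the explicit gauge translation-invariant / equal to the free corner field).
  - `iKLinearTransport_false_without_slack` — drop the `2δ` endpoint slack of the crude event
    (endpoints ON the arcs): the event is empty for every `R, δ` because the arcs lie in the
    frontier of the OPEN carrier; `P ≡ 0`; contradiction with §2. The statement's content lives
    in the slack convention of `embDomainCrossing`.
* §4 WHAT DOES NOT BITE (recorded so nobody re-runs it): numerics (2:1 boxes 0.1768 ± 0.0021 vs
  Cardy 0.17565, evidence IK-killtest-final.md on the item), the π/2 ↔ π/3 dictionary (checked by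
  hand again here), the "white ring" attack on conditional RSW (gauge influence is screened at
  rate `(7 - 4√3)^d ≈ 0.0718^d`), the open-strip colour-level commutation (holds because the
  honeycomb column kernel is the all-ones matrix), the tiny-`K₁` trivialisation of the line's
  `TransportCoupling` (fails on the `K₁⁻¹` clause). See the §4 module docblock at the end.
* `-- Targets`: none armed yet (payload.targets = []); pre-analysis of the six stubs of line
  `pinned-diagram-exchange` in the §5 module docblock at the end (no kill by inspection).
-/

noncomputable section

namespace Summit.CriticalPhenomena.CardyFormulaZ2.Cruxes.IKLinearTransport.Disproof

open scoped Classical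
open Filter Topology Set MeasureTheory
open Literature.Probability.Percolation Literature.Probability.LatticeModels
open Literature.Probability.RandomPlanarGeometry
open Summit.CriticalPhenomena.CardyFormulaZ2.Theorems.IKLinearTransport.Negative

/-! ## §1–§3 (LANDED): pointers

* `crux_iff_conjugateToTri`, `conjugateToTri_iff_cardyOnImages`, `crux_iff_cardyOnImages`,
  `cardyOnImages_congr_mul`, `conjugateToTri_congr_mul` (CruxConsequences.lean §0–§1);
* `cardyFunction_mem_Ioo`, `exists_limit_mem_Ioo_of_cardyOnImages`, `crux_forces_limits_mem_Ioo`,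
  `not_conjugateToTri_of_tendsto`, `not_conjugateToTri_of_not_tendsto`, `not_conjugateToTri_zero`
  (CruxConsequences.lean §2);
* `iKLinearTransport_false_without_axisBits` (white cross, witness `R0 = (1-i)·𝔻`, helpers `PnoAxis`,
  `edgesNA_not_mem`, `exists_adj_zero`, `one_le_re_of_mem_arc0`, …) and
  `iKLinearTransport_false_without_slack` (`noSlack_not_mem`) (LoadBearing.lean §3a/§3b).
-/

/-- The landed reformulation, re-checked from here (the crux ⟺ Cardy on `K`-images). [folklore] -/
example : Summit.CriticalPhenomena.CardyFormulaZ2.Theses.CardyIKTransport.IKLinearTransport ↔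
    ∃ K : ℂ ≃L[ℝ] ℂ, CardyOnImages Pik K :=
  crux_iff_cardyOnImages

/-- The landed necessary condition, re-checked from here. [folklore] -/
example : Summit.CriticalPhenomena.CardyFormulaZ2.Theses.CardyIKTransport.IKLinearTransport →
    ∀ R : ConformalRectangle, ∃ L ∈ Ioo (0 : ℝ) 1, Tendsto (Pik R) (𝓝[>] 0) (𝓝 L) :=
  crux_forces_limits_mem_Ioo

/-! ## §1b Covariance forced by the crux (LANDED: Covariance.lean, p74607)

* `tendsto_tri_map_mulLeft_iff`, `conjugateToTri_covariance`, `crux_forces_covariance`.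
-/

/-- The landed covariance, re-checked from here. [folklore] -/
example : Summit.CriticalPhenomena.CardyFormulaZ2.Theses.CardyIKTransport.IKLinearTransport →
    ∃ K : ℂ ≃L[ℝ] ℂ, ∀ (c : ℂ) (hc : c ≠ 0) (R : ConformalRectangle) (L : ℝ),
      Tendsto (Pik (R.map ((K.toHomeomorph.trans (Homeomorph.mulLeft₀ c hc)).trans
        K.symm.toHomeomorph))) (𝓝[>] 0) (𝓝 L) ↔ Tendsto (Pik R) (𝓝[>] 0) (𝓝 L) :=
  crux_forces_covariance

/-! ## §4 Attacks that do NOT bite (so far) — why the crux resists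

1. NUMERICS (kill criterion (i) of the route). Exact-sampling Monte Carlo of this very gauge by the
   route-review seats (evidence `IK-killtest-final.md`, `ADDENDUM-g3-CardyIKTransport.md` on
   stmt-5076): hard 2:1 crossings 0.1768 ± 0.0021 (pooled, L = 128…512) vs Cardy 0.175647
   (z = +0.6); 3:1 0.0600 ± 0.0031 vs 0.061638; squares 0.4975 ± 0.011 (= ½ by self-duality);
   bond-ℤ² in the same boxes shows the same finite-size pattern. Consistent with the crux with
   `K` a similarity. Not re-run here (no new observable would separate at this precision; a
   ratio test `P_IK / P_bond → 1` in identical boxes is the robust universality check if anybody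
   wants a sharper run).
2. DICTIONARY re-derived by hand (third independent check): Nienhuis' dilute weights at
   `λ = π/3` (`n = -2cos 4λ = 1`, DENSE branch ⇒ percolation class `c = 0`; the honeycomb
   degeneration `u = π/3` is the `x = 1 = 1/√(2-√(2-n))` dense integrable point of O(1), i.e.
   site-𝕋 at `p = ½`): `ρ₁ = sin²u`, `ρ₂…₅ = (√3/2) sin u` (the four turns), `ρ₆,₇ = sin²u`
   (straights), `ρ₈ = sin u sin(2π/3-u)`, `ρ₉ = sin u sin(u-π/3)` (pairings, sum `= sin²u`);
   hence colour marginal `∝ t(u)^{#odd faces}`, `t(u) = √3/(2 sin u)`, coin bias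
   `b(u) = sin(2π/3-u)/sin u`; `u = π/2`: `(t,b) = (√3/2, ½)`; `p = t/(1+t) = 2√3-3` ✓;
   `u = π/3`: `t = 1`, `b = 1` = site-𝕋 with one diagonal ✓. The four-fold XOR of the gauge's
   colours around the face with lower-left cell `f` telescopes to the plaquette bit at `f` in all
   sign cases of `Ico (min 0 ·) (max 0 ·)` ✓; axis bits uniform ⇒ every box marginal is the FREE
   corner field (the boundary-bit map `(A,B) ↦` first row/column is affine surjective with
   one-dimensional kernel) ✓ and the free fields are consistent under restriction ✓.
3. FORMAL JUNK hunted and not found: `HasCrossingLimit` is non-vacuous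
   (`exists_isUniformizing_holds`) and the tri side converges for EVERY rectangle
   (`exists_tendsto_triDomainCrossingProb`), so the `↔` pins the limits of `P_IK` (§1) — the crux
   is neither vacuous nor trivially true; a zero-length "crossing" (single vertex within `2δ` of
   both arcs) needs `4δ ≥ dist(arc 0, arc 2)`, void for small `δ`; for fixed Jordan `R` and
   `δ < d/1.3` (`d` = inradius near an interior point of arc 0) the `2δ`-neighbourhood of arc 0
   does contain lattice cells of `Ω` (no empty-event artefact on `δℤ²`, unlike the sparse product
   grids of stmt-5077's hazard note); non-measurability would only replace `μ` by its outer
   measure; `2√3-3 ∈ [0,1]` so `projIcc` is the identity; `R.map id = R` propositionally.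
4. DEGENERATIONS THAT DO NOT OBVIOUSLY FALSIFY (no theorem either way): dropping the plaquette
   defects (`t = 0`: `M(0,½)` = bond percolation on the renewal grid, percolation class expected),
   unfair coins (`b ≠ ½`: anisotropy, absorbed by a non-similarity `K` — exactly the IK(u) family),
   another `p ∈ (0,1)` (the self-dual line `b = ½`, expected percolation-universal = the content of
   CornerLineDescent). The `∃ K` SHAPE is robust; integrability (the exact point `t = √3/2`) is used
   by the proposed MECHANISM (Yang–Baxter commutation), not by the truth value. Only the axis bits
   (§3a: translation invariance / criticality of the gauge) and the event conventions (§3b) are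
   provably load-bearing so far.
5. WHITE-RING / FROZEN-GAUGE attack on the line's `ConditionalRSW` (conditioning on far cells
   might freeze the gauge bits and change box-crossing statistics): FAILS. Conditionally on all
   cells at sup-distance `≥ d` from a box, the re-anchored gauge increments of the box are parities
   of plaquette columns of height `≥ d`, i.e. `|1-2p|^d = (7-4√3)^d ≈ 0.0718^d`-close to fair and
   independent (exactly fair after ONE honeycomb row, `p = ½`); the law of the box colours is within
   total variation `C · perimeter · 0.0718^d` of the free corner field. So conditional RSW for far
   events reduces to unconditional RSW up to a super-exponentially small error; the `n = 1,2`
   cases are finite-energy. (Information for provers: the Gibbs–Markov + gauge structure gives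
   SCREENING for free; the open part of `ConditionalRSW` is plain RSW without FKG, = stmt-5911.)
6. OPEN-STRIP COMMUTATION (triage r1-1 found the DIAGRAM-level identity false on open strips):
   at COLOUR level the exchange does hold on open strips with free ends, because the honeycomb
   column kernel is the all-ones matrix `J` and the isotropic kernel `K_iso` has constant row sums
   (substitute `τ = σ ⊕ σ'`: `Σ_{σ'} t^{#odd} = Σ_τ t^{#{h : τ_h ≠ τ_{h+1}}}`), so
   `J K_iso = K_iso J`. Hence the marginal law off the resampled column is the same for `S` and
   `S ∆ {i,i+1}` on every finite box — clauses (i)+(ii) of `ExchangeKernels` are mutually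
   consistent; no kill there. MORE: `K_hc = J` means every honeycomb face column is a complete
   DECORRELATION WALL for colours (the cell column to its right is uniform and independent of
   everything to its left, at the level of colours — not of connectivity, which crosses the wall
   through the forced anti-diagonals); the `S`-mixed colour field is a product of independent free
   IK strips, one per maximal run of isotropic face columns (e.g. alternating `S`: independent
   2-wide IK double columns, adjacent-column XOR a two-state chain with flip rate `2√3-3`).
   KIT MONTE-CARLO j009186 (evidence `MC-j009186-summary.md` + compute manifest on stmt-5076; script
   `ikmix/main.py`: exact sampling of the box marginal, Hex-duality 0/4800 failures, 3×3 exact-weight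
   selftest ok): hard-way crossings of `2n × n` / `n × 2n` boxes, `n = 16, 32, 64, 128`, for EIGHT patterns
   `S` (iso = `P_IK`, hc = sheared 𝕋, alternating, period 3 (both phases), random, half/half, blocks of 8):
   ALL values in `[0.150, 0.210]`, no drift in `n`; iso LR/TB `0.17–0.19` (D₄; Cardy 2:1 = 0.1756 within
   1–2σ); hc `≈ 0.153` both ways (parallelogram modulus after the shear `K₀`); mixed patterns LR `≈ 0.19` vs
   TB `≈ 0.16`, a stable bounded `S`-dependent anisotropy (what a non-similarity `K_S` absorbs). RSW uniform in
   `S` (stub `ConditionalRSW` at `E = univ` = stmt-5911) is numerically sound: NOT KILLED.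
7. TINY-`K₁` TRIVIALISATION of `TransportCoupling`: a near-zero `K₁` makes every IK path
   shadowed by a single cell near `0`, but the converse clause asks IK paths to shadow the HUGE
   curves `K₁⁻¹(p')` within `ε`, which fails; the independent coupling fails both clauses. The
   stub has content; no degenerate witness.
8. LITERATURE: searchd / galaxy unavailable in this session (rc 75, 2026-08-16T00:5xZ); relied on
   the route's page-cited sources (arXiv:2502.08394 Thm 5.4/Rem 5.6, arXiv:2211.12379 §2.2/§3.6,
   arXiv:2012.11672) and the negatives index (7 CriticalPhenomena entries, none an instance).
   No printed claim that the `n = 1` dense dilute point is OFF the percolation class is known to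
   this seat; MDKP 2023 report `c = 0` CFT data for the whole `u`-family.

## §5 Targets (pre-analysis of line `pinned-diagram-exchange`; payload.targets = [] at this cycle)

* `stub_DiagramExchange` — finite identity on cylinders `ℤ/L`, `L ≥ 3`; verified `L ≤ 6` by three
  encodings; the lead's wave runs `L = 6,7` against the file's conventions. Not attacked here.
* `stub_PinnedExchange` (`ExchangeKernels`) — (i)–(iv) consistent (item 6 above; (iv) is stated
  surely, harmless); (v) quasi-locality uniform in `S,i,v,r` is the live target: corridor
  patterns (`ξ, ζ` locally white, `η` locally black) carry far dependence but cost `e^{-cr}`;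
  far-pinned diagram arcs through a window of height `4r` cost `e^{-c'r}` in a 3-wide strip.
  Plausible; the decisive computation is the influence decay of the diagram-conditioned chain
  (transfer matrix over (middle cell, transducer state)), not run this cycle.
* `stub_ConditionalRSW` — item 5 above: reduces to unconditional RSW (stmt-5911) up to
  `0.0718^n`; `n = 1, 2` by finite energy (`c ≤ (√3/2)^6/4`); unconditional RSW checked by MC for
  eight patterns up to `n = 128` (item 6, j009186). No kill.
* `stub_LinearTransport`, `stub_CouplingToLimits` — statements about an unbuilt coupling; item 7.
* `stub_CrudeCardyTri` — the shear `K₀ : (a,b) ↦ a + bζ`, `ζ = e^{iπ/3}`, maps the all-ANTI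
  triangulation (`S = ∅`: edges `e₁, e₂, (1,-1)`) onto the unit triangular lattice
  (`(1,-1) ↦ 1 - ζ = e^{-iπ/3}` ✓) and `S = ∅` colours are i.i.d. fair (`p = ½` plaquettes
  through the XOR gauge) ✓: true modulo crude-vs-G02 glue. No kill.
-/

end Summit.CriticalPhenomena.CardyFormulaZ2.Cruxes.IKLinearTransport.Disproof
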